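import Literature.Computability.Complexity.ScaledPCPHonestFE
import Literature.Computability.Complexity.PCPCoinPadding
import Literature.Computability.Complexity.ExpTimeMaps
import HarnessLib

/-!
# `E ⊆ PCP[poly, poly]` with proofs computable in `FE` (Babai–Fortnow–Lund, scaled down; Buhrman–Fortnow–Pavan Thm. 3.3)

Literature / complexity toolkit, the ASSEMBLY of the scaled Babai–Fortnow–Lund / BFLS verifier
(`ScaledPCPVerifier.lean`: `ScaledPCP.verifier' M T`, `completeness`, `soundness`) with its
machine layer (`ScaledPCPParamsFP`, `ScaledPCPTapeFP`, `ScaledPCPQueriesN/FP`, `ScaledPCPDecideN/FP`: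
the query and decision maps are `CodeFP` programmes), the `O(n)`-bit positions
(`ScaledPCPPositions.lean`) and the `FE` honest table (`ScaledPCPHonestFE.lean`), into the statement
consumed by `Literature.Computability.MetaComplexity` (`Hirahara2021_UP_searchUHS_of_Avg1P_of_pcp`):

* `exists_pair_decider_of_mem_E` — from `A ∈ E`, a machine deciding `x ∈ A` on the PAIRED input
  `⟨x, ε⟩` within `2^{c(2n+2)+c}` steps (composition of `fstF ∈ FP` with the `E`-decider,
  `TimeComputable.comp_holds`, `IsExpBounded`);
* `isPolyTime_verifier'` — `ScaledPCP.verifier' M T` is polynomial time (`queriesC`, `decideC`,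
  `CodeFP.polyTimeComputable`, the coin polynomial `coinPoly`);
* **`exists_pcp_of_mem_E`**: every `A ∈ E` has a polynomial-time PCP verifier with an exactly
  polynomial number of coins (`PCPVerifier.padCoins`), perfect completeness on a proof string
  computable in `FE`, and soundness error `≤ 1/2`.

All proved; no named fact.

## References

* L. Babai, L. Fortnow, C. Lund, *Non-deterministic exponential time has two-prover interactive
  protocols*, Comput. Complexity 1 (1991), §4–§7 [BabaiFortnowLund1991].
* L. Babai, L. Fortnow, L. Levin, M. Szegedy, *Checking computations in polylogarithmic time*,
  STOC 1991, §5 [BFLS1991].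
* H. Buhrman, L. Fortnow, A. Pavan, *Some results on derandomization*, Theory Comput. Syst. 38
  (2005), Thm. 3.3 (`E`-languages have PCPs with proofs computable in time `2^{O(n)}`)
  [BuhrmanFortnowPavan2004].
* S. Arora, B. Barak, *Computational Complexity: A Modern Approach*, CUP 2009, Def. 11.4, §11.5,
  §2.6.2 [AroraBarakCC2009].
-/

noncomputable section

open Polynomial

namespace Literature.Computability.Complexity

namespace ScaledPCP

open CodeFP Turing _root_.Computability PCPVerifier Brick

/-! ### A decider for the paired input -/

/-- `|fstF z| ≤ |z|`. [folklore] -/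
theorem length_fstF_le (z : List Bool) : (fstF z).length ≤ z.length := by
  have := length_fstF_sndF_le z; omega

/-- **From `A ∈ E`, a decider of `x ∈ A` on the paired input `⟨x, u⟩`** running within
`2^{c |⟨x,u⟩| + c}` steps. [cite: AroraBarakCC2009, §2.6.2 and §1.3 (Claim 1.6)] -/
theorem exists_pair_decider_of_mem_E {A : Language Bool} (hA : A ∈ E) :
    ∃ (M : TM2ComputableAux Bool Bool) (c : ℕ), ∀ y : List Bool, M.OutputsWithin y [A.boolIndicator (fstF y)] (2 ^ (c * y.length + c)) := by
  rw [E, Set.mem_iUnion] at hA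
  obtain ⟨c, K, hK⟩ := hA
  have hdec : TimeComputable (id : List Bool → List Bool) encodeBool A.boolIndicator fun n => K * 2 ^ (c * n) + K := hK
  obtain ⟨p₁, hp₁⟩ : PolyTimeComputable (id : List Bool → List Bool) id fstF := fstF_mem_FP
  have hmono : Monotone fun n : ℕ => K * 2 ^ (c * n) + K := fun a b h => by
    dsimp only; exact Nat.add_le_add_right (Nat.mul_le_mul_left _ (Nat.pow_le_pow_right (by norm_num) (Nat.mul_le_mul_left _ h))) _
  obtain ⟨C, hC⟩ := TimeComputable.comp_holds hdec hp₁ hmono (s := fun n => n) fun y => length_fstF_le y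
  have hexp : IsExpBounded fun n => C * (p₁.eval n + (K * 2 ^ (c * n) + K) + n) + C :=
    ((((IsExpBounded.poly p₁).add (IsExpBounded.shape c K)).add IsExpBounded.id).const_mul C).add (IsExpBounded.const C)
  obtain ⟨c', hc'⟩ := hexp
  obtain ⟨M, hM⟩ := hC.mono hc'
  exact ⟨M, c', fun y => hM y⟩

/-! ### The time bound of the tableau -/

/-- The step budget `T n = 2^{c (2n+2) + c}` of the paired run. [folklore] -/
def TofE (c n : ℕ) : ℕ := 2 ^ (c * (2 * n + 2) + c)

/-- `T` off `1ⁿ`. [folklore] -/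
theorem TofE_code (c : ℕ) : CodeFP unE natE (TofE c) :=
  (natPow.comp ((CodeFP.const _ 2).pair ((unMulConst c).comp (unSucc.comp (unSucc.comp (unAdd.comp ((CodeFP.id _).pair (CodeFP.id _))))) |>.pair
    (CodeFP.const _ c) |> fun h => unAdd.comp h))).congr fun n => by unfold TofE; dsimp only [id_eq]; ring_nf

/-- `T n ≤ 2^{3c n + 3c}`. [folklore] -/
theorem TofE_le (c n : ℕ) : TofE c n ≤ 2 ^ (3 * c * n + 3 * c) := by
  unfold TofE; exact Nat.pow_le_pow_right (by norm_num) (by nlinarith)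

/-! ### Polynomial time of the verifier -/

section Poly

variable (M : TM2ComputableAux Bool Bool) (T : ℕ → ℕ) (hTc : CodeFP unE natE T) (cT : ℕ) (hTb : ∀ n, T n ≤ 2 ^ (cT * n + cT))

/-- **The coin polynomial** `(2000 c₀⁷)² (X + 2)^{14} ≥ kF · bN`. [folklore] -/
def coinPoly : Polynomial ℕ := Polynomial.C ((2000 * c0 M cT ^ 7) ^ 2) * (Polynomial.X + Polynomial.C 2) ^ 14

include hTb in
/-- The coins are below the coin polynomial. [folklore] -/
theorem coinsN_le_coinPoly (n : ℕ) : coinsN M T n ≤ (coinPoly M cT).eval n := by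
  have h := params_le_WW M T cT hTb n
  have hk : kF M T n ≤ WW M cT n := h.2.2.2.2.2.2.1
  have hb : bN M T n ≤ WW M cT n := h.2.2.2.2.2.2.2.2.2
  unfold coinsN coinPoly
  simp only [eval_mul, eval_C, eval_pow, eval_add, eval_X]
  calc kF M T n * bN M T n ≤ WW M cT n * WW M cT n := Nat.mul_le_mul hk hb
    _ = (2000 * c0 M cT ^ 7) ^ 2 * (n + 2) ^ 14 := by unfold WW UU; ring

include hTc hTb in
/-- The coin count in unary, off the input string. [folklore] -/
theorem coinsUn : CodeFP strE unE (fun x => (verifier' M T).coins x.length) := by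
  have hW2 : CodeFP unE unE (fun n => WW M cT n ^ 2) := ((ulength unitE).comp ((unitsPow 2).comp (WWC M cT))).congr fun n => by simp
  have hle : ∀ n, coinsN M T n ≤ WW M cT n ^ 2 := fun n => by
    have h := params_le_WW M T cT hTb n
    unfold coinsN; rw [sq]; exact Nat.mul_le_mul h.2.2.2.2.2.2.1 h.2.2.2.2.2.2.2.2.2
  exact ((unOfNatMin.comp (hW2.pair (coinsNC M T hTc cT hTb))).comp strLength).congr fun x => by
    show min (coinsN M T x.length) _ = coinsN M T x.length
    exact min_eq_left (hle _)

include hTc hTb in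
/-- **The scaled verifier is polynomial time.** [cite: BFLS1991, §5] [cite: AroraBarakCC2009, Def. 11.4] -/
theorem isPolyTime_verifier' : (verifier' M T).IsPolyTime := by
  refine ⟨?_, ?_, ⟨coinPoly M cT, coinsN_le_coinPoly M T cT hTb⟩⟩
  · have h := (queriesC M T hTc cT hTb).polyTimeComputable
    rw [← natE_eq, ← listE_eq] at h
    exact h
  · exact (decideC M T hTc cT hTb).polyTimeComputable

end Poly

/-! ### The theorem -/

/-- **`E`-languages have PCPs with `FE` proofs** (BFP Thm. 3.3 in the tree's `PCPVerifier` model):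
for every `A ∈ E`, a polynomial-time verifier with exactly `p(n)` coins, a proof map `P ∈ FE` accepted
with probability `1` on `x ∈ A`, and acceptance probability `≤ 1/2` of every proof on `x ∉ A`.
[cite: BuhrmanFortnowPavan2004, Thm. 3.3] [cite: BabaiFortnowLund1991, §4–§7] -/
theorem exists_pcp_of_mem_E : ∀ A ∈ E, ∃ (V : PCPVerifier) (P : List Bool → List Bool) (p : Polynomial ℕ), V.IsPolyTime ∧
    (∀ n, V.coins n = p.eval n) ∧ P ∈ FE ∧
    (∀ x ∈ A, V.acceptProb x (fun i => (P x).getD i false) = 1) ∧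
    (∀ x ∉ A, ∀ π : ℕ → Bool, V.acceptProb x π ≤ 1 / 2) := by
  intro A hA
  obtain ⟨M, c, hM⟩ := exists_pair_decider_of_mem_E hA
  -- the run on `⟨x, ε⟩`
  set T : ℕ → ℕ := TofE c with hT
  have hTc : CodeFP unE natE T := TofE_code c
  have hTb : ∀ n, T n ≤ 2 ^ (3 * c * n + 3 * c) := TofE_le c
  set f : List Bool → Bool := fun y => A.boolIndicator (fstF y) with hf
  have hrun : ∀ x : List Bool, M.OutputsWithin (boolPair x []) [f (boolPair x [])] (T x.length) := by
    intro x
    have := hM (boolPair x [])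
    rw [length_boolPair, List.length_nil, Nat.add_zero] at this
    exact this
  have hfx : ∀ x : List Bool, f (boolPair x []) = A.boolIndicator x := fun x => by rw [hf]; dsimp only; rw [fstF_boolPair]
  -- the verifier, padded to exactly polynomially many coins
  obtain ⟨P, hP, hPacc⟩ := exists_table_FE M T hTc (3 * c) hTb
  refine ⟨(verifier' M T).padCoins fun n => (coinPoly M (3 * c)).eval n, P, coinPoly M (3 * c),
    isPolyTime_padCoins (isPolyTime_verifier' M T hTc (3 * c) hTb) (coinsUn M T hTc (3 * c) hTb) ⟨coinPoly M (3 * c), fun n => le_rfl⟩,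
    fun n => rfl, hP, fun x hx => ?_, fun x hx π => ?_⟩
  · rw [acceptProb_padCoins _ (coinsN_le_coinPoly M T (3 * c) hTb), hPacc x]
    exact completeness M T x (hrun x) (by rw [hfx]; exact ((Set.mem_iff_boolIndicator A x).1 hx))
  · rw [acceptProb_padCoins _ (coinsN_le_coinPoly M T (3 * c) hTb)]
    exact soundness M T x (hrun x) (by rw [hfx]; exact ((Set.notMem_iff_boolIndicator A x).1 hx)) π

end ScaledPCP

end Literature.Computability.Complexity

end
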